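import Summits.Parity.BatemanHorn.Theorems.RoughValueTransportBalancedSemiprimeLayerRootLevelTransfer
import HarnessLib

/-!
# Route `RoughValueTransport`, crux `BalancedSemiprimeLayer` (stmt-Parity-9469), line
# `Ideator4Sketch` = card `relative-mass-split`, stub S2 `stub_relativeTransfer`

Single-polynomial H1 (window mass) ∧ H2 (relative root level) for `g = fᵢ` ⟹ the SYSTEM relative
form consumed by the relative lever.

The two hypotheses count over ALL of `(0, x]` for the single polynomial `g = fᵢ`:
* H1: `∑_{m ∈ roughDivWindow} #{1 ≤ n ≤ x : m ∣ g(n)} ≤ C·δ·x` eventually;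
* H2: `∑_{e ≤ x^c sqfree} ∑_{s mod e} |∑_m (#{n ≤ x : n ≡ s (e), m ∣ g(n)} − #{n ≤ x : m ∣ g(n)}/e)|
  ≤ x^{1−η}` eventually.
The conclusion is over `posRange f x ⊆ (0, x]` with the spectator twist `e ∣ F(n)`, `F = ∏ⱼ fⱼ`:
`∑_m P(x; m, 1) ≤ C·δ·x` and `∑_e |∑_m (P(x; m, e) − (ρ_F(e)/e)·P(x; m, 1))| ≤ x^{1−η'}`
(`P = windowPairCount`, `ρ_F = polyRootCountMod f`).

Proof (bookkeeping, as in `stub_rootLevelTransfer`).  Write `A(m,e,s) = #{n ≤ x : n ≡ s (e), m ∣ g(n)}`,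
`B(m) = #{n ≤ x : m ∣ g(n)}`, `roots(e) = {s mod e : e ∣ F(s)}` (`#roots(e) = ρ_F(e)`),
`t(m) = #{n < n₀ : m ∣ g(n)}` with `n₀` the onset of positivity of the system, `K = ∑_{n<n₀} |g(n)|`.
* mass: `P(x; m, 1) ≤ #{n ≤ x : m ∣ g(n), 1 ∣ F(n)} = B(m)`;
* per `(m, e)`: `P(x;m,e) = ∑_{s ∈ roots(e)} A(m,e,s) − θ₁`, `P(x;m,1) = B(m) − θ₂`, `θ₁, θ₂ ∈ [0, t(m)]`,
  hence `P(x;m,e) − (ρ/e)·P(x;m,1) = ∑_{s ∈ roots(e)} (A(m,e,s) − B(m)/e) − θ₁ + (ρ/e)·θ₂`;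
* per `e`, any finset `T`: `|∑_{m∈T} (…)| ≤ ∑_{s mod e} |∑_{m∈T} (A − B/e)| + 2K`
  (`roots(e) ⊆ range e`, `ρ ≤ e`, `∑_m t(m) ≤ K` since `g` has no integer root in degree `≥ 2`);
* summing over the `≤ x^c` squarefree `e`: `≤ x^{1−η} + 2K·x^c ≤ x^{1−η'}`, `η' = min(η,1/2)/2`,
  once `c ≤ 1/4`.

References: bookkeeping only; everything used is PROVED in the tree
(`eval_ne_zero_of_irreducible_of_two_le`, `sum_card_filter_dvd_eval_le`,
`card_filter_dvd_pair_eq_sum_classes`, `card_filter_pair_le_windowPairCount_add`,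
`windowPairCount_le_and_le`, `exists_forall_eval_pos`, `card_filter_dvd_eval_eq_polyRootCountMod`,
`PolyPrimeCountBrun.polyRootCountMod_eq_single_prod`, `polyRootCountMod_le`).
-/

noncomputable section

open Polynomial Filter Finset
open Literature.NumberTheory.Sieve
open scoped BigOperators

namespace Summit.Parity.BatemanHorn.Cruxes.BalancedSemiprimeLayer.RelativeMassSplit

open Summit.Parity.BatemanHorn.Cruxes.BalancedSemiprimeLayer.RoughRelaxedDivisorSieve

/-! ### Per-modulus decomposition of the relative remainder -/

/-- **Per-`(m, e)` decomposition of the relative remainder.**  For `e ≥ 1` and every `m`, with `n₀`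
the onset of positivity of the system:
`P(x;m,e) − (ρ_F(e)/e)·P(x;m,1) = ∑_{s mod e, e ∣ F(s)} (A(m,e,s) − B(m)/e) − θ₁ + (ρ_F(e)/e)·θ₂`
with `A(m,e,s) = #{1 ≤ n ≤ x : n ≡ s (e), m ∣ fᵢ(n)}`, `B(m) = #{1 ≤ n ≤ x : m ∣ fᵢ(n)}` and
`0 ≤ θ₁, θ₂ ≤ #{n < n₀ : m ∣ fᵢ(n)}`. [folklore] -/
theorem relRem_eq_sum_classes {k : ℕ} (f : Fin k → ℤ[X]) (i : Fin k) {n₀ : ℕ}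
    (hn₀ : ∀ n : ℕ, n₀ ≤ n → ∀ j, 0 < (f j).eval (n : ℤ)) (x m : ℕ) {e : ℕ} (he : 0 < e) :
    ∃ θ₁ θ₂ : ℝ, 0 ≤ θ₁ ∧ θ₁ ≤ #((range n₀).filter fun n : ℕ => (m : ℤ) ∣ (f i).eval (n : ℤ)) ∧
      0 ≤ θ₂ ∧ θ₂ ≤ #((range n₀).filter fun n : ℕ => (m : ℤ) ∣ (f i).eval (n : ℤ)) ∧
      (windowPairCount f i x m e : ℝ) -
          (polyRootCountMod f e : ℝ) / e * (windowPairCount f i x m 1 : ℝ) =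
        (∑ s ∈ (range e).filter (fun s : ℕ => (e : ℤ) ∣ (∏ j, f j).eval (s : ℤ)),
          (((#((Ioc 0 x).filter fun n : ℕ => n ≡ s [MOD e] ∧ (m : ℤ) ∣ (f i).eval (n : ℤ))) : ℝ) -
            ((#((Ioc 0 x).filter fun n : ℕ => (m : ℤ) ∣ (f i).eval (n : ℤ))) : ℝ) / e)) -
          θ₁ + (polyRootCountMod f e : ℝ) / e * θ₂ := by
  have hlo := (windowPairCount_le_and_le f i hn₀ x m e).1
  have hhi := card_filter_pair_le_windowPairCount_add f i hn₀ x m e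
  have hlo1 := (windowPairCount_le_and_le f i hn₀ x m 1).1
  have hhi1 := card_filter_pair_le_windowPairCount_add f i hn₀ x m 1
  -- for `e = 1` the spectator clause `1 ∣ F(n)` is vacuous
  have h1 : ((Ioc 0 x).filter fun n : ℕ =>
      (m : ℤ) ∣ (f i).eval (n : ℤ) ∧ ((1 : ℕ) : ℤ) ∣ (∏ j, f j).eval (n : ℤ)) =
      (Ioc 0 x).filter fun n : ℕ => (m : ℤ) ∣ (f i).eval (n : ℤ) :=
    Finset.filter_congr fun n _ => by simp
  rw [h1] at hlo1 hhi1
  -- the number of root classes of `F` mod `e`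
  have hρ : #((range e).filter (fun s : ℕ => (e : ℤ) ∣ (∏ j, f j).eval (s : ℤ))) =
      polyRootCountMod f e := by
    rw [card_filter_dvd_eval_eq_polyRootCountMod,
      ← PolyPrimeCountBrun.polyRootCountMod_eq_single_prod f e]
  -- the fibration of the pair count over the root classes
  have hP : ((#((Ioc 0 x).filter fun n : ℕ =>
      (m : ℤ) ∣ (f i).eval (n : ℤ) ∧ (e : ℤ) ∣ (∏ j, f j).eval (n : ℤ)) : ℕ) : ℝ) =
      ∑ s ∈ (range e).filter (fun s : ℕ => (e : ℤ) ∣ (∏ j, f j).eval (s : ℤ)),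
        ((#((Ioc 0 x).filter fun n : ℕ => n ≡ s [MOD e] ∧ (m : ℤ) ∣ (f i).eval (n : ℤ))) : ℝ) := by
    rw [card_filter_dvd_pair_eq_sum_classes (f i) (∏ j, f j) m he x]
    push_cast
    rfl
  refine ⟨(#((Ioc 0 x).filter fun n : ℕ =>
        (m : ℤ) ∣ (f i).eval (n : ℤ) ∧ (e : ℤ) ∣ (∏ j, f j).eval (n : ℤ)) : ℝ) -
      windowPairCount f i x m e,
    (#((Ioc 0 x).filter fun n : ℕ => (m : ℤ) ∣ (f i).eval (n : ℤ)) : ℝ) -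
      windowPairCount f i x m 1, ?_, ?_, ?_, ?_, ?_⟩
  · rw [sub_nonneg]
    exact_mod_cast hlo
  · have h' : ((#((Ioc 0 x).filter fun n : ℕ =>
        (m : ℤ) ∣ (f i).eval (n : ℤ) ∧ (e : ℤ) ∣ (∏ j, f j).eval (n : ℤ)) : ℕ) : ℝ) ≤
        (windowPairCount f i x m e : ℝ) +
          #((range n₀).filter fun n : ℕ => (m : ℤ) ∣ (f i).eval (n : ℤ)) := by
      exact_mod_cast hhi
    linarith
  · rw [sub_nonneg]
    exact_mod_cast hlo1
  · have h' : ((#((Ioc 0 x).filter fun n : ℕ => (m : ℤ) ∣ (f i).eval (n : ℤ)) : ℕ) : ℝ) ≤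
        (windowPairCount f i x m 1 : ℝ) +
          #((range n₀).filter fun n : ℕ => (m : ℤ) ∣ (f i).eval (n : ℤ)) := by
      exact_mod_cast hhi1
    linarith
  · rw [Finset.sum_sub_distrib, Finset.sum_const, nsmul_eq_mul, hρ, ← hP]
    ring

/-! ### One sieve modulus: the relative remainder sum against the per-class sums -/

/-- **Per-`e` relative transfer.**  For `e ≥ 1`, ANY finset `T` of moduli, `n₀` the onset of
positivity and `fᵢ` without roots in `ℕ`:
`|∑_{m ∈ T} (P(x;m,e) − (ρ_F(e)/e)·P(x;m,1))| ≤ ∑_{s mod e} |∑_{m ∈ T} (A(m,e,s) − B(m)/e)| + 2·∑_{n<n₀} |fᵢ(n)|`.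
[folklore] -/
theorem abs_sum_relRem_le_sum_classes {k : ℕ} {f : Fin k → ℤ[X]} (i : Fin k) {n₀ : ℕ}
    (hn₀ : ∀ n : ℕ, n₀ ≤ n → ∀ j, 0 < (f j).eval (n : ℤ))
    (hg : ∀ n : ℕ, (f i).eval (n : ℤ) ≠ 0) (T : Finset ℕ) (x : ℕ) {e : ℕ} (he : 0 < e) :
    |∑ m ∈ T, ((windowPairCount f i x m e : ℝ) -
        (polyRootCountMod f e : ℝ) / e * (windowPairCount f i x m 1 : ℝ))| ≤
      (∑ s ∈ range e, |∑ m ∈ T,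
          (((#((Ioc 0 x).filter fun n : ℕ => n ≡ s [MOD e] ∧ (m : ℤ) ∣ (f i).eval (n : ℤ))) : ℝ) -
            ((#((Ioc 0 x).filter fun n : ℕ => (m : ℤ) ∣ (f i).eval (n : ℤ))) : ℝ) / e)|) +
        2 * ∑ n ∈ range n₀, (((f i).eval (n : ℤ)).natAbs : ℝ) := by
  have h := fun m => relRem_eq_sum_classes f i hn₀ x m he
  choose θ₁ θ₂ hθ₁0 hθ₁B hθ₂0 hθ₂B hθr using h
  have hρ0 : (0 : ℝ) ≤ (polyRootCountMod f e : ℝ) / e := by positivity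
  have hρ1 : (polyRootCountMod f e : ℝ) / e ≤ 1 := by
    have he' : (0 : ℝ) < e := by exact_mod_cast he
    rw [div_le_one he']
    exact_mod_cast polyRootCountMod_le f e
  have hsum : ∑ m ∈ T, ((windowPairCount f i x m e : ℝ) -
        (polyRootCountMod f e : ℝ) / e * (windowPairCount f i x m 1 : ℝ)) =
      (∑ s ∈ (range e).filter (fun s : ℕ => (e : ℤ) ∣ (∏ j, f j).eval (s : ℤ)), ∑ m ∈ T,
          ((((#((Ioc 0 x).filter fun n : ℕ => n ≡ s [MOD e] ∧ (m : ℤ) ∣ (f i).eval (n : ℤ))) : ℝ) -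
            ((#((Ioc 0 x).filter fun n : ℕ => (m : ℤ) ∣ (f i).eval (n : ℤ))) : ℝ) / e))) -
        ∑ m ∈ T, θ₁ m + ∑ m ∈ T, (polyRootCountMod f e : ℝ) / e * θ₂ m := by
    rw [Finset.sum_comm, ← Finset.sum_sub_distrib, ← Finset.sum_add_distrib]
    exact Finset.sum_congr rfl fun m _ => hθr m
  have hK : ∀ θ : ℕ → ℝ,
      (∀ m, θ m ≤ #((range n₀).filter fun n : ℕ => (m : ℤ) ∣ (f i).eval (n : ℤ))) →
        ∑ m ∈ T, θ m ≤ ∑ n ∈ range n₀, (((f i).eval (n : ℤ)).natAbs : ℝ) := by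
    intro θ hθ
    calc ∑ m ∈ T, θ m
        ≤ ∑ m ∈ T, ((#((range n₀).filter fun n : ℕ => (m : ℤ) ∣ (f i).eval (n : ℤ)) : ℕ) : ℝ) :=
          Finset.sum_le_sum fun m _ => hθ m
      _ ≤ ∑ n ∈ range n₀, (((f i).eval (n : ℤ)).natAbs : ℝ) := by
          exact_mod_cast sum_card_filter_dvd_eval_le (f i) T n₀ hg
  have hθ₁sum := hK θ₁ hθ₁B
  have hθ₂sum : ∑ m ∈ T, (polyRootCountMod f e : ℝ) / e * θ₂ m ≤
      ∑ n ∈ range n₀, (((f i).eval (n : ℤ)).natAbs : ℝ) :=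
    (Finset.sum_le_sum fun m _ => mul_le_of_le_one_left (hθ₂0 m) hρ1).trans (hK θ₂ hθ₂B)
  have hθ₁nn : 0 ≤ ∑ m ∈ T, θ₁ m := Finset.sum_nonneg fun m _ => hθ₁0 m
  have hθ₂nn : 0 ≤ ∑ m ∈ T, (polyRootCountMod f e : ℝ) / e * θ₂ m :=
    Finset.sum_nonneg fun m _ => mul_nonneg hρ0 (hθ₂0 m)
  have key : ∀ a b t : ℝ, 0 ≤ b → 0 ≤ t → |a - b + t| ≤ |a| + b + t := by
    intro a b t hb ht
    calc |a - b + t| ≤ |a - b| + |t| := abs_add_le _ _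
      _ ≤ |a| + |b| + |t| := add_le_add (abs_sub _ _) le_rfl
      _ = |a| + b + t := by rw [abs_of_nonneg hb, abs_of_nonneg ht]
  rw [hsum]
  refine (key _ _ _ hθ₁nn hθ₂nn).trans ?_
  rw [two_mul, ← add_assoc]
  refine add_le_add (add_le_add ((Finset.abs_sum_le_sum_abs _ _).trans ?_) hθ₁sum) hθ₂sum
  exact Finset.sum_le_sum_of_subset_of_nonneg (Finset.filter_subset _ _)
    fun s _ _ => abs_nonneg _

/-! ### The stub -/

/-- **S2 `stub_relativeTransfer`.**  For every Bateman–Horn system `f` and every coordinate `i` of degree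
`≥ 2`, the SINGLE-POLYNOMIAL statements H1 (window mass `O(δx)`) and H2 (relative root level) for
`g = fᵢ`, counted over all of `(0, x]`, imply the SYSTEM relative form consumed by the lever: the actual
mass `Σ_m P(x;m,1) ≤ C·δ·x` and `Σ_{e ≤ x^c sqfree} |Σ_m (P(x;m,e) − (ρ_F(e)/e)·P(x;m,1))| ≤ x^{1−η}`
eventually (`P = windowPairCount` counts over `posRange f x ⊆ (0, x]`; the fibre of `e ∣ F(n)` over the
root classes `s` of `F = ∏ⱼ fⱼ` mod `e` and the onset of positivity `n₀(f)` are absorbed as in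
`stub_rootLevelTransfer`: an irreducible `g` of degree `≥ 2` has no integer root, so
`Σ_m #{n < n₀ : m ∣ g(n)} ≤ Σ_{n<n₀} |g(n)|`; take `c₀' = min(c₀¹, c₀², 1/4)`, `η' = min(η,1/2)/2`). [folklore] -/
theorem stub_relativeTransfer :
    ∀ (k : ℕ) (f : Fin k → ℤ[X]), IsBatemanHornSystem f → ∀ i : Fin k, 2 ≤ (f i).natDegree →
      (∃ c₀ : ℝ, 0 < c₀ ∧ ∀ c : ℝ, 0 < c → c ≤ c₀ → ∃ C : ℝ, ∀ δ : ℝ, 0 < δ → δ ≤ c →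
        ∀ᶠ x : ℕ in atTop,
          (∑ m ∈ roughDivWindow (f i).natDegree δ c x,
            (#((Ioc 0 x).filter fun n : ℕ => (m : ℤ) ∣ (f i).eval (n : ℤ)) : ℝ)) ≤ C * δ * x) →
      (∃ c₀ : ℝ, 0 < c₀ ∧ ∀ c : ℝ, 0 < c → c ≤ c₀ → ∀ δ : ℝ, 0 < δ → δ ≤ c →
        ∃ η : ℝ, 0 < η ∧ ∀ᶠ x : ℕ in atTop,
          (∑ e ∈ (Icc 1 ⌊(x : ℝ) ^ c⌋₊).filter Squarefree, ∑ s ∈ range e,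
            |∑ m ∈ roughDivWindow (f i).natDegree δ c x,
              ((#((Ioc 0 x).filter fun n : ℕ => n ≡ s [MOD e] ∧ (m : ℤ) ∣ (f i).eval (n : ℤ)) : ℝ) -
                (#((Ioc 0 x).filter fun n : ℕ => (m : ℤ) ∣ (f i).eval (n : ℤ)) : ℝ) / e)|) ≤
            (x : ℝ) ^ (1 - η)) →
      ∃ c₀ : ℝ, 0 < c₀ ∧ ∀ c : ℝ, 0 < c → c ≤ c₀ → ∃ C : ℝ, ∀ δ : ℝ, 0 < δ → δ ≤ c →
        ∃ η : ℝ, 0 < η ∧ ∀ᶠ x : ℕ in atTop,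
          (∑ m ∈ roughDivWindow (f i).natDegree δ c x, (windowPairCount f i x m 1 : ℝ)) ≤ C * δ * x ∧
          (∑ e ∈ (Icc 1 ⌊(x : ℝ) ^ c⌋₊).filter Squarefree,
            |∑ m ∈ roughDivWindow (f i).natDegree δ c x,
              ((windowPairCount f i x m e : ℝ) -
                (polyRootCountMod f e : ℝ) / e * (windowPairCount f i x m 1 : ℝ))|) ≤ (x : ℝ) ^ (1 - η) := by
  intro k f hf i hdeg hH1 hH2
  obtain ⟨c₁, hc₁, H1⟩ := hH1
  obtain ⟨c₂, hc₂, H2⟩ := hH2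
  obtain ⟨n₀, hn₀⟩ := exists_forall_eval_pos hf
  have hg : ∀ n : ℕ, (f i).eval (n : ℤ) ≠ 0 :=
    fun n => eval_ne_zero_of_irreducible_of_two_le (hf.irreducible i) hdeg n
  set K : ℝ := ∑ n ∈ range n₀, (((f i).eval (n : ℤ)).natAbs : ℝ) with hK
  have hK0 : 0 ≤ K := Finset.sum_nonneg fun n _ => Nat.cast_nonneg _
  refine ⟨min (min c₁ c₂) (1 / 4), lt_min (lt_min hc₁ hc₂) (by norm_num), fun c hc hcc => ?_⟩
  have hcc1 : c ≤ c₁ := hcc.trans ((min_le_left _ _).trans (min_le_left _ _))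
  have hcc2 : c ≤ c₂ := hcc.trans ((min_le_left _ _).trans (min_le_right _ _))
  have hc4 : c ≤ 1 / 4 := hcc.trans (min_le_right _ _)
  obtain ⟨C, hC⟩ := H1 c hc hcc1
  refine ⟨C, fun δ hδ hδc => ?_⟩
  obtain ⟨η, hη, hev⟩ := H2 c hc hcc2 δ hδ hδc
  -- the new saving `η' = min(η, 1/2)/2`
  have hm0 : 0 < min η (1 / 2) := lt_min hη (by norm_num)
  have hm1 : min η (1 / 2) ≤ η := min_le_left _ _
  have hm2 : min η (1 / 2) ≤ 1 / 2 := min_le_right _ _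
  refine ⟨min η (1 / 2) / 2, by positivity, ?_⟩
  have hT1 : Tendsto (fun x : ℕ => (x : ℝ) ^ (η - min η (1 / 2) / 2)) atTop atTop :=
    (tendsto_rpow_atTop (by linarith)).comp tendsto_natCast_atTop_atTop
  have hT2 : Tendsto (fun x : ℕ => (x : ℝ) ^ (1 - min η (1 / 2) / 2 - c)) atTop atTop :=
    (tendsto_rpow_atTop (by linarith)).comp tendsto_natCast_atTop_atTop
  filter_upwards [hC δ hδ hδc, hev, hT1.eventually_ge_atTop 2, hT2.eventually_ge_atTop (4 * K),
    eventually_ge_atTop 1] with x hx1' hx2' h1 h2 hx1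
  have hX : (1 : ℝ) ≤ x := by exact_mod_cast hx1
  have hXpos : (0 : ℝ) < x := by linarith
  refine ⟨?_, ?_⟩
  · -- the mass clause: `P(x; m, 1) ≤ #{1 ≤ n ≤ x : m ∣ fᵢ(n)}`
    refine le_trans (Finset.sum_le_sum fun m _ => ?_) hx1'
    have hle := (windowPairCount_le_and_le f i hn₀ x m 1).1
    have h1f : ((Ioc 0 x).filter fun n : ℕ =>
        (m : ℤ) ∣ (f i).eval (n : ℤ) ∧ ((1 : ℕ) : ℤ) ∣ (∏ j, f j).eval (n : ℤ)) =
        (Ioc 0 x).filter fun n : ℕ => (m : ℤ) ∣ (f i).eval (n : ℤ) :=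
      Finset.filter_congr fun n _ => by simp
    rw [h1f] at hle
    exact_mod_cast hle
  · -- the remainder clause
    -- per-`e` transfer
    have hpt : ∀ e ∈ (Icc 1 ⌊(x : ℝ) ^ c⌋₊).filter Squarefree,
        |∑ m ∈ roughDivWindow (f i).natDegree δ c x, ((windowPairCount f i x m e : ℝ) -
            (polyRootCountMod f e : ℝ) / e * (windowPairCount f i x m 1 : ℝ))| ≤
          (∑ s ∈ range e, |∑ m ∈ roughDivWindow (f i).natDegree δ c x,
            (((#((Ioc 0 x).filter fun n : ℕ => n ≡ s [MOD e] ∧ (m : ℤ) ∣ (f i).eval (n : ℤ))) : ℝ) -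
              ((#((Ioc 0 x).filter fun n : ℕ => (m : ℤ) ∣ (f i).eval (n : ℤ))) : ℝ) / e)|) +
            2 * K := by
      intro e he
      rw [mem_filter, mem_Icc] at he
      exact abs_sum_relRem_le_sum_classes i hn₀ hg _ x he.1.1
    -- the number of sieve moduli
    have hE : (#((Icc 1 ⌊(x : ℝ) ^ c⌋₊).filter Squarefree) : ℝ) ≤ (x : ℝ) ^ c := by
      have hxc0 : (0 : ℝ) ≤ (x : ℝ) ^ c := Real.rpow_nonneg (Nat.cast_nonneg _) _
      calc (#((Icc 1 ⌊(x : ℝ) ^ c⌋₊).filter Squarefree) : ℝ) ≤ #(Icc 1 ⌊(x : ℝ) ^ c⌋₊) := by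
            exact_mod_cast card_filter_le _ _
        _ = ⌊(x : ℝ) ^ c⌋₊ := by rw [Nat.card_Icc, Nat.add_sub_cancel]
        _ ≤ (x : ℝ) ^ c := Nat.floor_le hxc0
    -- exponent budget
    have e1 : (x : ℝ) ^ (1 - η) * (x : ℝ) ^ (η - min η (1 / 2) / 2) =
        (x : ℝ) ^ (1 - min η (1 / 2) / 2) := by
      rw [← Real.rpow_add hXpos]
      congr 1
      ring
    have e2 : (x : ℝ) ^ c * (x : ℝ) ^ (1 - min η (1 / 2) / 2 - c) =
        (x : ℝ) ^ (1 - min η (1 / 2) / 2) := by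
      rw [← Real.rpow_add hXpos]
      congr 1
      ring
    have hA : (x : ℝ) ^ (1 - η) * 2 ≤ (x : ℝ) ^ (1 - min η (1 / 2) / 2) := by
      rw [← e1]
      exact mul_le_mul_of_nonneg_left h1 (Real.rpow_nonneg hXpos.le _)
    have hB : (x : ℝ) ^ c * (4 * K) ≤ (x : ℝ) ^ (1 - min η (1 / 2) / 2) := by
      rw [← e2]
      exact mul_le_mul_of_nonneg_left h2 (Real.rpow_nonneg hXpos.le _)
    calc ∑ e ∈ (Icc 1 ⌊(x : ℝ) ^ c⌋₊).filter Squarefree,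
          |∑ m ∈ roughDivWindow (f i).natDegree δ c x, ((windowPairCount f i x m e : ℝ) -
            (polyRootCountMod f e : ℝ) / e * (windowPairCount f i x m 1 : ℝ))|
        ≤ ∑ e ∈ (Icc 1 ⌊(x : ℝ) ^ c⌋₊).filter Squarefree,
            ((∑ s ∈ range e, |∑ m ∈ roughDivWindow (f i).natDegree δ c x,
              (((#((Ioc 0 x).filter fun n : ℕ => n ≡ s [MOD e] ∧ (m : ℤ) ∣ (f i).eval (n : ℤ))) : ℝ) -
                ((#((Ioc 0 x).filter fun n : ℕ => (m : ℤ) ∣ (f i).eval (n : ℤ))) : ℝ) / e)|) +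
              2 * K) :=
          Finset.sum_le_sum hpt
      _ = (∑ e ∈ (Icc 1 ⌊(x : ℝ) ^ c⌋₊).filter Squarefree,
            ∑ s ∈ range e, |∑ m ∈ roughDivWindow (f i).natDegree δ c x,
              (((#((Ioc 0 x).filter fun n : ℕ => n ≡ s [MOD e] ∧ (m : ℤ) ∣ (f i).eval (n : ℤ))) : ℝ) -
                ((#((Ioc 0 x).filter fun n : ℕ => (m : ℤ) ∣ (f i).eval (n : ℤ))) : ℝ) / e)|) +
            (#((Icc 1 ⌊(x : ℝ) ^ c⌋₊).filter Squarefree) : ℝ) * (2 * K) := by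
          rw [Finset.sum_add_distrib, Finset.sum_const, nsmul_eq_mul]
      _ ≤ (x : ℝ) ^ (1 - η) + (x : ℝ) ^ c * (2 * K) :=
          add_le_add hx2' (mul_le_mul_of_nonneg_right hE (by positivity))
      _ ≤ (x : ℝ) ^ (1 - min η (1 / 2) / 2) := by nlinarith [hA, hB, hK0]

end Summit.Parity.BatemanHorn.Cruxes.BalancedSemiprimeLayer.RelativeMassSplit

end
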